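import Mathlib
import Summits.Ventures.HodgeRepro2.T5CyclotomicSubfieldDecomposition
import Summits.Ventures.HodgeRepro2.T5CyclotomicTwentyOneSatake

/-!
# THE INERT REGIME OF THE RECORD'S SATAKE CHAIN FOR EVERY CM SUBFIELD OF `ℚ(ζₘ)`: `q = p^{ord(p · H_F)/2}`

Tier-5 support N3 / §G-N4.2 (seat p3, gen 81). Files 293 (the place `v` of `F⁺` under `𝔭 ∣ p` stays prime in `F`
iff `(−1) · H_F ∈ ⟨p · H_F⟩`), 286 (`f(𝔭/p) = ord(p · H_F)`) and 291 (the chain with numerals at every place that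
stays prime, `q = p^{f(v/p)}`) combine, for EVERY CM subfield `F ⊆ ℚ(ζₘ)` (any degree) and every `p ∤ m`:

* `inertiaDeg_eq_two_mul_of_mem`: at a non-split `v`, `f(𝔭/p) = 2 f(v/p)`; **`two_mul_inertiaDeg_eq_orderOf_mk`**:
  `2 f(v/p) = ord(p · H_F)`, so `f(v/p) = ord(p · H_F) / 2` and `N(v) = p^{ord(p · H_F)/2}`;
* **`chainNumerals_of_mem`**: the Satake chain of the record's pair at `v` with `q = p^{f(v/p)}`, `c₁ = q³ + 1`,
  `c₂ = q⁴`, `c₃ = q⁴ + q`; **`chainNumerals_of_mem'`**: the same with `q = p^{ord(p · H_F)/2}` — every number in the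
  inert regime of the chain is read off `(ℤ/mℤ)ˣ / H_F`, for every abelian CM field presented inside a cyclotomic field.

§8(d): uses an L-value-free non-vanishing device: NO.
-/

open NumberField NumberField.IsCMField IsCyclotomicExtension.Rat Ideal IsDedekindDomain
  IsDedekindDomain.HeightOneSpectrum
open Summit.Ventures.HodgeRepro2.T5CyclotomicSubfieldInertiaDeg
  Summit.Ventures.HodgeRepro2.T5CyclotomicSubfieldDecomposition
  Summit.Ventures.HodgeRepro2.T5CyclotomicTwentyOneSatake
  Summit.Ventures.HodgeRepro2.T5GlobalLatticeAlmostAll Summit.Ventures.HodgeRepro2.T5CyclotomicSevenHeckeCommutative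

namespace Summit.Ventures.HodgeRepro2.T5CyclotomicSubfieldSatake

variable (m : ℕ) [NeZero m] (L : Type*) [Field L] [NumberField L] [IsCyclotomicExtension {m} ℚ L] [IsCMField L]
  (F : IntermediateField ℚ L) [IsCMField F]
variable (p : ℕ) [hp : Fact p.Prime] (hpm : p.Coprime m)
  (𝔭 : Ideal (𝓞 F)) [h𝔭 : 𝔭.IsPrime] [h𝔭p : 𝔭.LiesOver (span {(p : ℤ)})]
  (v : HeightOneSpectrum (𝓞 (maximalRealSubfield F))) [hPv : 𝔭.LiesOver v.asIdeal]

include hpm h𝔭 h𝔭p hPv in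
/-- **`f(𝔭/p) = 2 f(v/p)` at a non-split place** (`(−1) · H_F ∈ ⟨p · H_F⟩`): `f(𝔭/v) = 2` (file 282) and the tower. -/
theorem inertiaDeg_eq_two_mul_of_mem
    (hmem : (QuotientGroup.mk (-1) : (ZMod m)ˣ ⧸ zmodSubgroup m L F) ∈
      Subgroup.zpowers (QuotientGroup.mk (ZMod.unitOfCoprime p hpm))) :
    𝔭.inertiaDeg ℤ = 2 * v.asIdeal.inertiaDeg ℤ := by
  haveI : IsGalois ℚ F := T5CyclotomicUnramified.isGalois_intermediateField L m F
  have he : 𝔭.ramificationIdx ℤ = 1 :=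
    T5CyclotomicUnramified.ramificationIdx_eq_one p L F ((Nat.Prime.coprime_iff_not_dvd hp.out).mp hpm) 𝔭
  have h1 : (v.asIdeal.primesOver (𝓞 F)).ncard = 1 :=
    (ncard_primesOver_eq_one_iff_mem_zpowers' m L F p hpm 𝔭 v).mpr hmem
  exact T5SexticRecordSatake.inertiaDeg_eq_two_mul_of_ncard_eq_one F v 𝔭 he h1

include hpm h𝔭 h𝔭p hPv in
/-- **`2 f(v/p) = ord(p · H_F)` at a non-split place**: `f(v/p)` is read off `(ℤ/mℤ)ˣ / H_F`. -/
theorem two_mul_inertiaDeg_eq_orderOf_mk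
    (hmem : (QuotientGroup.mk (-1) : (ZMod m)ˣ ⧸ zmodSubgroup m L F) ∈
      Subgroup.zpowers (QuotientGroup.mk (ZMod.unitOfCoprime p hpm))) :
    2 * v.asIdeal.inertiaDeg ℤ =
      orderOf (QuotientGroup.mk (ZMod.unitOfCoprime p hpm) : (ZMod m)ˣ ⧸ zmodSubgroup m L F) := by
  rw [← inertiaDeg_eq_two_mul_of_mem m L F p hpm 𝔭 v hmem, inertiaDeg_eq_orderOf_mk m L F p hpm 𝔭]

include hpm h𝔭 h𝔭p hPv in
/-- `f(v/p) = ord(p · H_F) / 2` at a non-split place. -/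
theorem inertiaDeg_under_eq_orderOf_mk_div_two
    (hmem : (QuotientGroup.mk (-1) : (ZMod m)ˣ ⧸ zmodSubgroup m L F) ∈
      Subgroup.zpowers (QuotientGroup.mk (ZMod.unitOfCoprime p hpm))) :
    v.asIdeal.inertiaDeg ℤ =
      orderOf (QuotientGroup.mk (ZMod.unitOfCoprime p hpm) : (ZMod m)ˣ ⧸ zmodSubgroup m L F) / 2 := by
  rw [← two_mul_inertiaDeg_eq_orderOf_mk m L F p hpm 𝔭 v hmem]
  omega

include hpm h𝔭 h𝔭p hPv in
/-- **THE SATAKE CHAIN OF THE RECORD'S PAIR AT EVERY NON-SPLIT PLACE OF EVERY CM SUBFIELD OF `ℚ(ζₘ)`**, with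
`q = p^{f(v/p)}`: cells `gₙ` with `deg Tₙ = (q³ + 1) q^{4n−3}`, `T₁ T_{n+2} = T_{n+3} + (q − 1) T_{n+2} + q⁴ T_{n+1}`,
`T₁² = T₂ + (q − 1) T₁ + (q⁴ + q) T₀` (file 291's `chainNumerals_of_map_eq` on the `w` given by file 293). -/
theorem chainNumerals_of_mem
    (hmem : (QuotientGroup.mk (-1) : (ZMod m)ˣ ⧸ zmodSubgroup m L F) ∈
      Subgroup.zpowers (QuotientGroup.mk (ZMod.unitOfCoprime p hpm)))
    {r : ℕ} (l : Fin r → 𝓞 F) (k : Type*) [Field k] [CharZero k]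
    (hl : Submodule.span (𝓞 (maximalRealSubfield F)) (Set.range l) = ⊤)
    {H : Matrix (Fin 3) (Fin 3) F} (hH : H.IsHermitian) (hdet : IsUnit H.det)
    (hbad : ∀ w : HeightOneSpectrum (𝓞 F), w.asIdeal.LiesOver v.asIdeal → w ∉ badSet H) :
    ChainNumerals F v l k H (p ^ v.asIdeal.inertiaDeg ℤ) ((p ^ v.asIdeal.inertiaDeg ℤ) ^ 3 + 1)
      ((p ^ v.asIdeal.inertiaDeg ℤ) ^ 4) ((p ^ v.asIdeal.inertiaDeg ℤ) ^ 4 + p ^ v.asIdeal.inertiaDeg ℤ) := by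
  haveI : v.asIdeal.LiesOver (span {(p : ℤ)}) := Ideal.LiesOver.tower_bot 𝔭 v.asIdeal _
  obtain ⟨w, hmap⟩ := (exists_map_eq_iff_mem_zpowers m L F p hpm 𝔭 v).mpr hmem
  exact chainNumerals_of_map_eq F v p w hmap l k hl hH hdet (hbad w (liesOver_of_map_eq F v w hmap)) _ _ _ _
    rfl rfl rfl rfl

include hpm h𝔭 h𝔭p hPv in
/-- **THE SAME WITH `q = p^{ord(p · H_F)/2}`**: every number of the inert regime is read off `(ℤ/mℤ)ˣ / H_F`. -/
theorem chainNumerals_of_mem'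
    (hmem : (QuotientGroup.mk (-1) : (ZMod m)ˣ ⧸ zmodSubgroup m L F) ∈
      Subgroup.zpowers (QuotientGroup.mk (ZMod.unitOfCoprime p hpm)))
    {r : ℕ} (l : Fin r → 𝓞 F) (k : Type*) [Field k] [CharZero k]
    (hl : Submodule.span (𝓞 (maximalRealSubfield F)) (Set.range l) = ⊤)
    {H : Matrix (Fin 3) (Fin 3) F} (hH : H.IsHermitian) (hdet : IsUnit H.det)
    (hbad : ∀ w : HeightOneSpectrum (𝓞 F), w.asIdeal.LiesOver v.asIdeal → w ∉ badSet H) :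
    ChainNumerals F v l k H
      (p ^ (orderOf (QuotientGroup.mk (ZMod.unitOfCoprime p hpm) : (ZMod m)ˣ ⧸ zmodSubgroup m L F) / 2))
      ((p ^ (orderOf (QuotientGroup.mk (ZMod.unitOfCoprime p hpm) : (ZMod m)ˣ ⧸ zmodSubgroup m L F) / 2)) ^ 3 + 1)
      ((p ^ (orderOf (QuotientGroup.mk (ZMod.unitOfCoprime p hpm) : (ZMod m)ˣ ⧸ zmodSubgroup m L F) / 2)) ^ 4)
      ((p ^ (orderOf (QuotientGroup.mk (ZMod.unitOfCoprime p hpm) : (ZMod m)ˣ ⧸ zmodSubgroup m L F) / 2)) ^ 4 +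
        p ^ (orderOf (QuotientGroup.mk (ZMod.unitOfCoprime p hpm) : (ZMod m)ˣ ⧸ zmodSubgroup m L F) / 2)) := by
  rw [← inertiaDeg_under_eq_orderOf_mk_div_two m L F p hpm 𝔭 v hmem]
  exact chainNumerals_of_mem m L F p hpm 𝔭 v hmem l k hl hH hdet hbad

end Summit.Ventures.HodgeRepro2.T5CyclotomicSubfieldSatake
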